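import Literature.IUT.HodgeArakelov.KummerPrimeStrips
import Literature.IUT.HodgeArakelov.GaussianMonoidsGood
import Literature.IUT.LogThetaLattice.PilotWeights

/-!
# [IUTchII] Def 4.9 (v)/(vi) local data over the [IUTchI] kits: the archimedean "sort of Kummer structure",
# and place data from the numerical place kit (bridge)

Merge bridge (abc-iut cell, layer L6; no re-typing of landed modules). `KummerPrimeStrips.lean` (p405008,
[IUTchII] Def 4.9 (ii)–(viii)) types the archimedean local datum of an `F^{⊢▶×μ}`-prime-strip as the
INTERFACE `ArchTriMuDatum` = (`O^▷(A)`, splitting, `ArchimedeanKummerData`), where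
`ArchimedeanKummerData O` records Def 4.9 (v) p. 157: "the units `(‡D^⊢_w)^×` … form a topological group
[noncanonically isomorphic to `S¹`], … related to the … inductive system of units via a system of
compatible surjections `(‡D^⊢_w)^× ↠ O^{×μ_N}(A)` [i.e., where the kernel … is the subgroup of
`N`-torsion] … — a sort of Kummer structure". It also left `-- TODO-merge: PlaceData.ofWeights` against
abc-iut-L6-t3's numerical place kit `Literature.IUT.LogThetaLattice.PlaceWeights` (PilotWeights.lean,
[IUTchIII] Rmk 2.4.2 (ii)). This file supplies:

* `ArchimedeanKummerData.tautological O` — for ANY commutative monoid `O`: the circle `O^×` itself with the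
  quotient maps `O^× ↠ O^×/μ_N = O^{×μ_N}` is such a structure (surjective, compatible with the transition
  maps, kernel = `N`-torsion — all PROVED). This is the structure of Def 4.9 (v) once `(‡D^⊢_w)^×` is
  identified with the compact factor `O^×_{C^⊢_v}` ([IUTchI] Ex 3.4 (ii): "isomorphic — but not
  canonically! — to the compact factor of `D^⊢_v`"; the printed indeterminacy "up to the unique nontrivial
  automorphism of `(‡D^⊢_w)^×`" is exactly the choice of that identification), and it certifies that the
  interface is inhabited;
* (the Def 4.9 (v) datum `ArchTriMuDatum.ofArch` of an `ArchLocalFrobenioid`, [IUTchI] Ex 3.4, is filed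
  separately in `ArchTriMuDatumBridge.lean`);
* `PlaceData.ofWeights l W` (the TODO above) and `LogRealDatum.ofWeights W v` (`log(p_v) > 0` of the place
  kit as the `R_{≥0}(−)`-datum of [IUTchII] Prop 4.1 (ii) / 4.3 (ii)).

S. Mochizuki, *Inter-universal Teichmüller theory II*, kurims Dec-2020 manuscript, Def 4.9 (v)–(vi) p. 157;
*I*, kurims May-2020 manuscript, Ex 3.4 pp. 80–82, Def 3.1 pp. 61–62. Claim key `Mochizuki2012` DISPUTED
(D-0012): definitions and elementary verifications only; nothing here asserts a disputed claim.
-/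

namespace Literature.IUT.HodgeArakelov

open Literature.IUT.LogThetaLattice
open scoped NNReal

universe u

/-! ### 1. The tautological archimedean Kummer structure (Def 4.9 (v)) -/

/-- **[IUTchII] Def 4.9 (v) p. 157, the "sort of Kummer structure", tautological model**: for a commutative
monoid `O` (`O^▷(A)`), the group `O^×` with the quotient maps `O^× ↠ O^×/μ_N(A) = O^{×μ_N}(A)`, `N ≥ 1` —
compatible with the transition surjections and with kernel the `N`-torsion, as printed.
[cite: Mochizuki2012, Def 4.9 (v) p.157] -/
def ArchimedeanKummerData.tautological (O : Type u) [CommMonoid O] : ArchimedeanKummerData.{u, u} O where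
  circle := CommGrpCat.of Oˣ
  proj N := QuotientGroup.mk' (rootsOfUnity N O)
  proj_surjective N _ := QuotientGroup.mk'_surjective _
  proj_compatible h := by
    ext x
    rfl
  ker_proj N z _ := by
    change (QuotientGroup.mk' (rootsOfUnity N O)) z = 1 ↔ _
    rw [QuotientGroup.mk'_apply, QuotientGroup.eq_one_iff, mem_rootsOfUnity]

/-- In the tautological structure the circle IS `O^×`. [cite: Mochizuki2012, Def 4.9 (v) p.157] -/
theorem ArchimedeanKummerData.tautological_circle (O : Type u) [CommMonoid O] :
    ((ArchimedeanKummerData.tautological O).circle : Type u) = Oˣ := rfl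

/-! ### 2. Place data and `log(p_v)` from the numerical place kit of [IUTchIII] Rmk 2.4.2 (ii) -/

section Weights

variable {V : Type u} [Fintype V]

/-- The type of a place read off a `PlaceWeights` kit (`isBad` has priority; bad places are
nonarchimedean by `not_isArc_of_isBad`, [IUTchI] Def 3.1 (b)). [cite: Mochizuki2012, Def 3.1 (f) p.62] -/
def placeKindOfWeights (W : PlaceWeights V) (v : V) : PlaceKind :=
  if W.isBad v then PlaceKind.bad else if W.isArc v then PlaceKind.arch else PlaceKind.goodNonarch

/-- The type is `bad` exactly at the bad places of the kit. [cite: Mochizuki2012, Def 3.1 (f) p.62] -/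
theorem placeKindOfWeights_eq_bad_iff (W : PlaceWeights V) (v : V) :
    placeKindOfWeights W v = PlaceKind.bad ↔ W.isBad v := by
  unfold placeKindOfWeights
  by_cases hb : W.isBad v
  · simp [hb]
  · by_cases ha : W.isArc v <;> simp [hb, ha]

/-- The type is `arch` exactly at the archimedean places of the kit (which are never bad).
[cite: Mochizuki2012, Def 3.1 (e) p.62] -/
theorem placeKindOfWeights_eq_arch_iff (W : PlaceWeights V) (v : V) :
    placeKindOfWeights W v = PlaceKind.arch ↔ W.isArc v := by
  unfold placeKindOfWeights
  by_cases hb : W.isBad v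
  · have : ¬ W.isArc v := W.not_isArc_of_isBad v hb
    simp [hb, this]
  · by_cases ha : W.isArc v <;> simp [hb, ha]

/-- **`PlaceData.ofWeights`** (the `TODO-merge` of `KummerPrimeStrips.PlaceData`): the place data of
[IUTchII] Def 4.9 (vi) (prime `l`, type of each place, `V^bad ≠ ∅`) determined by the numerical place kit
`PlaceWeights` of [IUTchIII] Rmk 2.4.2 (ii) (`exists_isBad` = [IUTchI] Def 3.1 (b) "`V^bad_mod` … nonempty").
[cite: Mochizuki2012, Def 4.9 (vi) p.157] -/
def PlaceData.ofWeights (l : ℕ) (W : PlaceWeights V) : PlaceData V where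
  ell := l
  kind := placeKindOfWeights W
  bad_nonempty := by
    obtain ⟨v, hv⟩ := W.exists_isBad
    exact ⟨v, (placeKindOfWeights_eq_bad_iff W v).mpr hv⟩

/-- The prime recorded is `l`. [cite: Mochizuki2012, Def 4.9 (vi) p.157] -/
theorem PlaceData.ofWeights_ell (l : ℕ) (W : PlaceWeights V) : (PlaceData.ofWeights l W).ell = l := rfl

/-- The bad places of `PlaceData.ofWeights` are those of the kit (so `torsionOrder` is `2l` exactly there).
[cite: Mochizuki2012, Def 4.9 (iii) p.155] -/
theorem PlaceData.ofWeights_kind_eq_bad_iff (l : ℕ) (W : PlaceWeights V) (v : V) :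
    (PlaceData.ofWeights l W).kind v = PlaceKind.bad ↔ W.isBad v :=
  placeKindOfWeights_eq_bad_iff W v

/-- `R_{≥0}(−)_v` with `log(p_v) > 0` read off the place kit ([IUTchII] Prop 4.1 (ii) p. 121 / 4.3 (ii)
p. 127; the kit's `logp_pos`). [cite: Mochizuki2012, Prop 4.1 (ii) p.121] -/
noncomputable def LogRealDatum.ofWeights (W : PlaceWeights V) (v : V) : LogRealDatum where
  logp := ⟨W.logp v, (W.logp_pos v).le⟩
  logp_pos := by
    change (0 : ℝ) < W.logp v
    exact W.logp_pos v

/-- Its distinguished element is the kit's `log(p_v)`. [cite: Mochizuki2012, Prop 4.1 (ii) p.121] -/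
theorem LogRealDatum.ofWeights_logp (W : PlaceWeights V) (v : V) :
    ((LogRealDatum.ofWeights W v).logp : ℝ) = W.logp v := rfl

/-- At an archimedean place of the kit, `log(p_v) = 1` (`p_v = e`), i.e. `LogRealDatum.ofWeights W v` is the
archimedean datum with distinguished element `1`. [cite: Mochizuki2012, Prop 4.3 (ii) p.127] -/
theorem LogRealDatum.ofWeights_logp_arc (W : PlaceWeights V) (v : V) (hv : W.isArc v) :
    ((LogRealDatum.ofWeights W v).logp : ℝ) = 1 := by
  rw [LogRealDatum.ofWeights_logp, W.logp_arc v hv]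

end Weights

end Literature.IUT.HodgeArakelov
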